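import Literature.MathematicalPhysics.QuantumFieldTheory.Balaban1983to89.Beta.RemainderLocality
import Literature.MathematicalPhysics.QuantumFieldTheory.Balaban1983to89.Beta.EntrywiseVolumeLimit

/-!
# The (F2) socket of `Beta.RemainderLocality`: restricted test-configuration limits FROM entrywise volume limits of torus
kernels — the (ii-a) engine `Beta.EntrywiseVolumeLimit` feeds the field `PolLeavesTFac.hconv` (`Beta.RemainderLocalitySockets`)

HONEST FRAMING (cell rule, page 1 of everything).  Discharging `BetaPertH` makes Bałaban's UV stability UNCONDITIONAL —
a real constructive-QFT result; it is NOT the continuum limit and NOT the Clay problem.  This module discharges NOTHING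
of `BetaPertH` and instantiates NOTHING of Bałaban's (4.35) test configurations; it is the kernel-checked DICTIONARY
showing that the hypothesis field (F2) `PolLeavesTFac.hconv` of `Beta.RemainderLocality` (the (4.35) test configurations
of the torus leaf list, RESTRICTED to a fixed finite set of lattice sites, converge as the torus grows) has exactly the
SHAPE delivered by the cell's entrywise volume-limit engine (`Beta.EntrywiseVolumeLimit`, the (ii-a) class of the wall):
(S1) restriction to finitely many lattice sites read on the torus of side T is a continuous linear map
`restrictCLM T e : (TPt d T → ℂ) →L[ℂ] (ι → ℂ)`; (S2) `hconv_socket`: ENTRYWISE limits of a family of torus kernels at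
lattice representatives give the (F2) limit of the restricted kernel COLUMNS in the finite product; (S3)
`hconv_periodise₂`: for the periodisations `Ŝ_T` of a jointly periodic, exponentially decaying `ℤ^d` kernel `S` — the
engine's object (`Beta.tendsto_periodise₂'` of `Beta.EntrywiseVolumeLimit`: `Ŝ_T([y],[x]) → S(y,x)`; [Balaban1984PropagatorsI] p. 36
*"relating G on the torus to G on the whole lattice ηZ^d in the usual way"*) — the restricted columns converge:
`restrictCLM (N_n M) e (Ŝ_{N_nM}(·, [x])) → (S(e i, x))_i` whenever `N_n → ∞`.  Bałaban's test configurations are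
generated by the step's minimizers / 𝐇-operators (block-periodic torus Green's functions, [Balaban1987RG1] p. 282) —
the class these statements are about (wall item (ii-a′)); feeding THEM is the located step, not done here.
Every statement is [folklore] bookkeeping; no `Literature` fact is minted; no `axiom`, no `sorry`.

ABSOLUTE RULE (cell).  "No internally-minted statement may enter as a cited fact. Every hypothesis is either
kernel-proved in this package or a verbatim quotation of a PUBLISHED theorem with page reference. The manuscript(s)
under audit are NOT citable for their own disputed steps — they are the thing under adjudication; programme-internal
(2001/route/tribunal) claims are never citable."
-/

namespace Literature.MathematicalPhysics.QuantumFieldTheory.Balaban1983to89.Beta.RemainderLocalitySockets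

open Literature.MathematicalPhysics.QuantumFieldTheory.Balaban1983to89
open Literature.MathematicalPhysics.QuantumFieldTheory.Balaban1983to89.B13ScaleTransfer (Pt)
open Literature.MathematicalPhysics.QuantumFieldTheory.Balaban1983to89.TreeLengthTorus (TPt proj)
open Filter Topology

noncomputable section

variable {d : ℕ}

/-! ## 1. (S1) Restriction to finitely many lattice sites, read on a torus, as a continuous linear map -/

/-- **Restriction of a torus configuration to finitely many lattice sites** `e i` (read at their residues mod T): a
continuous ℂ-linear map `(TPt d T → ℂ) →L[ℂ] (ι → ℂ)` (a product of coordinate projections).  (The index type `ι` is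
universe-polymorphic here; in `RemainderLocality.PolLeavesTFac` the fibre `V Y` lives in `Type`, so the dictionary
`V Y := ι → ℂ` takes `ι : Type` — e.g. a subtype of `Pt d`.) [folklore] -/
def restrictCLM (T : ℕ) {ι : Type*} (e : ι → Pt d) : (TPt d T → ℂ) →L[ℂ] (ι → ℂ) :=
  ContinuousLinearMap.pi fun i => ContinuousLinearMap.proj (proj T (e i))

/-- `restrictCLM T e f i = f [e i]`. [folklore] -/
@[simp] theorem restrictCLM_apply (T : ℕ) {ι : Type*} (e : ι → Pt d) (f : TPt d T → ℂ) (i : ι) :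
    restrictCLM T e f i = f (proj T (e i)) := rfl

/-! ## 2. (S2) The socket: entrywise kernel limits ⟹ the (F2) limit of the restricted columns -/

/-- **THE (F2) SOCKET.**  A family of torus kernels `K n` on the tori with `T n` sites per direction whose ENTRIES at
lattice representatives converge, `K n [y] [x] → K∞ y x`, has its COLUMNS at `[x]`, restricted to finitely many lattice
sites, converging in the finite product: `restrictCLM (T n) e (K n · [x]) → (K∞ (e i) x)_i` — the shape of
`RemainderLocality.PolLeavesTFac.hconv` with `V Y := ι → ℂ`, `r n Y := restrictCLM (T n) e`, test configuration := the
kernel column. [folklore] -/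
theorem hconv_socket {T : ℕ → ℕ} (K : (n : ℕ) → TPt d (T n) → TPt d (T n) → ℂ) (Kinf : Pt d → Pt d → ℂ)
    (hK : ∀ y x : Pt d, Tendsto (fun n => K n (proj (T n) y) (proj (T n) x)) atTop (𝓝 (Kinf y x)))
    {ι : Type*} [Fintype ι] (e : ι → Pt d) (x : Pt d) :
    Tendsto (fun n => restrictCLM (T n) e (fun y => K n y (proj (T n) x))) atTop (𝓝 fun i => Kinf (e i) x) :=
  tendsto_pi_nhds.2 fun i => by simpa using hK (e i) x

/-- The real-valued form (kernels valued in ℝ, read in ℂ). [folklore] -/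
theorem hconv_socket_real {T : ℕ → ℕ} (K : (n : ℕ) → TPt d (T n) → TPt d (T n) → ℝ) (Kinf : Pt d → Pt d → ℝ)
    (hK : ∀ y x : Pt d, Tendsto (fun n => K n (proj (T n) y) (proj (T n) x)) atTop (𝓝 (Kinf y x)))
    {ι : Type*} [Fintype ι] (e : ι → Pt d) (x : Pt d) :
    Tendsto (fun n => restrictCLM (T n) e (fun y => (K n y (proj (T n) x) : ℂ))) atTop
      (𝓝 fun i => (Kinf (e i) x : ℂ)) :=
  hconv_socket (fun n y x => (K n y x : ℂ)) (fun y x => (Kinf y x : ℂ))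
    (fun y x => (Complex.continuous_ofReal.tendsto _).comp (hK y x)) e x

/-! ## 3. (S3) The engine's object: periodisations of a decaying periodic `ℤ^d` kernel -/

/-- The engine's torus sites and residues ARE the torus leaf list's: `Beta.siteOf d T = TreeLengthTorus.proj T` (`Beta.InfiniteVolume`)
(both are the coordinatewise residue map `ℤ^d → (ℤ/T)^d`). [folklore] -/
theorem siteOf_eq_proj (T : ℕ) (y : Pt d) : siteOf d T y = proj T y := rfl

/-- **THE (ii-a) ENGINE FEEDS (F2).**  For a `ℤ^d` kernel `S` jointly periodic under every period `T n` and exponentially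
decaying (`Decay₂ S C δ`, δ > 0), and tori with `T n → ∞` sites per direction, the columns of the periodisations
`Ŝ_{T n}(·, [x])` restricted to finitely many lattice sites converge to `(S(e i, x))_i`
(`Beta.tendsto_periodise₂'` through the socket). [folklore] -/
theorem hconv_periodise₂ {T : ℕ → ℕ} [∀ n, NeZero (T n)] {S : Kernel₂ d} {C δ : ℝ}
    (hS : ∀ n, IsPeriodic₂ (T n) S) (hdec : Decay₂ S C δ) (hδ : 0 < δ) (hT : Tendsto T atTop atTop)
    {ι : Type*} [Fintype ι] (e : ι → Pt d) (x : Pt d) :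
    Tendsto (fun n => restrictCLM (T n) e (fun y => (periodise₂ (T n) S y (proj (T n) x) : ℂ))) atTop
      (𝓝 fun i => (S (e i) x : ℂ)) :=
  hconv_socket_real (fun n y x => periodise₂ (T n) S y x) S
    (fun y x => by simpa only [siteOf_eq_proj] using tendsto_periodise₂' hS hdec hδ hT y x) e x

/-- The same on the tori of the leaf list, `T n = N n · M` sites per direction with `N n → ∞` cubes of side `M ≥ 1`
(the index convention of `RemainderLimitTorus.PolLeavesTLoc` / `RemainderLocality.PolLeavesTFac`). [folklore] -/
theorem hconv_periodise₂_cubes {N : ℕ → ℕ} [∀ n, NeZero (N n)] {M : ℕ} [NeZero M] {S : Kernel₂ d} {C δ : ℝ}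
    (hS : ∀ n, IsPeriodic₂ (N n * M) S) (hdec : Decay₂ S C δ) (hδ : 0 < δ) (hN : Tendsto N atTop atTop)
    {ι : Type*} [Fintype ι] (e : ι → Pt d) (x : Pt d) :
    Tendsto (fun n => restrictCLM (N n * M) e (fun y => (periodise₂ (N n * M) S y (proj (N n * M) x) : ℂ))) atTop
      (𝓝 fun i => (S (e i) x : ℂ)) :=
  have hT : Tendsto (fun n => N n * M) atTop atTop :=
    tendsto_atTop_mono (fun n => Nat.le_mul_of_pos_right (N n) (Nat.pos_of_neZero M)) hN
  hconv_periodise₂ (T := fun n => N n * M) hS hdec hδ hT e x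

/-! ## 4. Non-vacuity: the engine's hypotheses are met by the identity kernel -/

/-- The Kronecker kernel is jointly periodic under every period and decays with any rate (engine lemmas
`isPeriodic₂_kdelta`, `decay₂_kdelta`), so `hconv_periodise₂` applies to it on any exhausting sequence of tori: the
restricted columns of its periodisations converge to the restricted columns of the identity. [folklore] -/
example {T : ℕ → ℕ} [∀ n, NeZero (T n)] (hT : Tendsto T atTop atTop) {ι : Type*} [Fintype ι] (e : ι → Pt d)
    (x : Pt d) :
    Tendsto (fun n => restrictCLM (T n) e
      (fun y => (periodise₂ (T n) (kdelta (d := d)) y (proj (T n) x) : ℂ))) atTop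
      (𝓝 fun i => (kdelta (d := d) (e i) x : ℂ)) :=
  hconv_periodise₂ (fun n => isPeriodic₂_kdelta (T n)) (decay₂_kdelta 1)
    one_pos hT e x

end

end Literature.MathematicalPhysics.QuantumFieldTheory.Balaban1983to89.Beta.RemainderLocalitySockets
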